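import Literature.AlgebraicGeometry.Frobenioids.BaseCategoryTheoreticityExamples
import HarnessLib

/-!
# Frobenioids I, §3: Examples 3.5 and 3.10 — the typed claims PROVED (node ids `FrdI:Ex3.5`, `FrdI:Ex3.10`)

Mochizuki, *The geometry of Frobenioids I: the general theory*, Kyushu J. Math. **62** (2008)
293–400, kurims text pp. 69–70 (Example 3.5) and p. 72 (Example 3.10)
[cite: MochizukiFrdI2008, Ex. 3.5 p.69] [cite: MochizukiFrdI2008, Ex. 3.10 p.72]. PROOF-ONLY companion of
`BaseCategoryTheoreticityExamples.lean` (seat abc-iut-L1-t3): its two named claim bundles `Ex35.claims`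
and `Ex310.claims G` are theorems (`Ex35.claims_holds`, `Ex310.claims_holds`).

* Ex. 3.5: in the one-object category `D` of `𝔽 = ℤ_{≥0} ⋊ N_{≥1}` the endomorphism `γ = (1, 1)` is an
  FSMI-morphism (fiberwise surjective: `γ · (c + m - 1, m) = (c, m) · γ`; monic: left cancellation;
  irreducible: degrees multiply to `1` and divisors add to `1`), hence `D` is not of FSMFF-type; the
  operations of `C` (one object, monoid `𝔽 × 𝔽`, base = first factor) are of Frobenius-normalized type
  (`(0, (a,1))^d · (0,(c,d)) = (0,(c,d)) · (0,(a,1))` in `𝔽 × 𝔽`), of isotropic type (an isometric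
  pre-step is the identity) and not of group-like type (`Φ = ℤ_{≥0}`).
* Ex. 3.10: the same computations with a group `G` in the first factor; `D = ` one-object category of `G`
  is a groupoid, hence of FSM-type; and for `α : 𝔽 → Z(G)` nontrivial through `𝔽 ↠ N_{≥1}`, say
  `α(0, n) ≠ 1`, the base-identity Frobenius-type endomorphism `(1, (0, n))` is moved by the twist
  `(g, f) ↦ (g · α(f), f)` to `(α(0,n), (0,n))`, which is not base-identity.
No statement of the paper is strengthened; no side is taken on [IUTchIII] Cor. 3.12.
-/

namespace Literature.AlgebraicGeometry.Frobenioids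

open CategoryTheory

/-! ### Arithmetic helpers: `N_{≥1}`, `𝔽`, powers in one-object categories -/

/-- In `N_{≥1}`, `a · b = 1` forces `a = b = 1`. [cite: MochizukiFrdI2008, Def. 1.1 (iii) p.20] -/
private theorem pnat_eq_one_and_of_mul_eq_one {a b : ℕ+} (h : a * b = 1) : a = 1 ∧ b = 1 := by
  have h' : (a : ℕ) * b = 1 := by rw [← PNat.mul_coe, h]; rfl
  exact ⟨PNat.coe_eq_one_iff.mp (Nat.eq_one_of_mul_eq_one_right h'),
    PNat.coe_eq_one_iff.mp (Nat.eq_one_of_mul_eq_one_left h')⟩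

/-- Powers in `F_M` of an element of Frobenius degree `1`: `(a, 1)^n = (n · a, 1)`.
[cite: MochizukiFrdI2008, Def. 1.1 (iii) p.20] -/
theorem ElemFrobenioidMonoid.pow_of_degFr_eq_one {M : Type*} [CommMonoid M] (u : ElemFrobenioidMonoid M)
    (hu : u.degFr = 1) (n : ℕ) : (u ^ n).div = u.div ^ n ∧ (u ^ n).degFr = 1 := by
  induction n with
  | zero => exact ⟨by rw [pow_zero, pow_zero]; rfl, by rw [pow_zero]; rfl⟩
  | succ n ih =>
    rw [pow_succ, ElemFrobenioidMonoid.mul_div, ElemFrobenioidMonoid.mul_degFr, ih.1, ih.2, hu,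
      PNat.one_coe, pow_one, pow_succ, mul_one]
    exact ⟨rfl, rfl⟩

/-- In a one-object category, the power of an endomorphism in the monoid `End` is its power in the
underlying monoid (both multiplications are the monoid's). [cite: MochizukiFrdI2008, Def. 1.1 (iii) p.20] -/
theorem singleObj_end_pow_eq {M : Type*} [Monoid M] {x : SingleObj M} (f : End x) (n : ℕ) :
    (show M from f ^ n) = (show M from f) ^ n := by
  induction n with
  | zero =>
    rw [pow_zero, pow_zero]
    rfl
  | succ n ih =>
    rw [pow_succ, pow_succ, ← ih]
    rfl

/-! ### Example 3.5 -/

namespace Ex35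

/-- **Example 3.5** (FrdI p. 69): "the endomorphism `1 ∈ ℤ_{≥0} ⊆ 𝔽` of the unique object of `D` is …
an FSM-morphism … and irreducible" — `γ = (1,1)` is an FSMI-morphism of the one-object category of `𝔽`.
[cite: MochizukiFrdI2008, Ex. 3.5 p.69] -/
theorem isFSMI_gen :
    IsFSMI (show SingleObj.star StandardFrobenioid ⟶ SingleObj.star _ from StandardFrobenioid.gen) := by
  refine ⟨⟨fun X γ => ?_, ⟨fun g h e => ?_⟩⟩, ?_, fun X β α e => ?_⟩
  · -- fiberwise surjective: `γ' · (c · (m-1)·1, m) = (c, m) · γ'` for `(c, m) : X → ⋆`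
    let c : StandardFrobenioid := γ
    refine ⟨SingleObj.star _,
      (⟨c.div * Multiplicative.ofAdd ((c.degFr : ℕ) - 1), c.degFr⟩ : StandardFrobenioid),
      StandardFrobenioid.gen, ?_⟩
    show StandardFrobenioid.gen *
        (⟨c.div * Multiplicative.ofAdd ((c.degFr : ℕ) - 1), c.degFr⟩ : StandardFrobenioid) =
      c * StandardFrobenioid.gen
    have hm : 0 < (c.degFr : ℕ) := c.degFr.pos
    ext
    · show Multiplicative.ofAdd (1 : ℕ) * (c.div * Multiplicative.ofAdd ((c.degFr : ℕ) - 1)) ^ ((1 : ℕ+) : ℕ) =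
        c.div * Multiplicative.ofAdd (1 : ℕ) ^ (c.degFr : ℕ)
      rw [PNat.one_coe, pow_one]
      apply (Multiplicative.toAdd (α := ℕ)).injective
      rw [toAdd_mul, toAdd_mul, toAdd_mul, toAdd_pow, toAdd_ofAdd, toAdd_ofAdd, smul_eq_mul, mul_one]
      omega
    · show (1 : ℕ+) * c.degFr = c.degFr * 1
      rw [one_mul, mul_one]
  · -- monomorphism: `γ · g = γ · h ⇒ g = h`
    let g' : StandardFrobenioid := g
    let h' : StandardFrobenioid := h
    have e' : StandardFrobenioid.gen * g' = StandardFrobenioid.gen * h' := e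
    have hd := congrArg ElemFrobenioidMonoid.div e'
    have hn := congrArg ElemFrobenioidMonoid.degFr e'
    simp only [StandardFrobenioid.gen, ElemFrobenioidMonoid.mul_div, ElemFrobenioidMonoid.mul_degFr,
      PNat.one_coe, pow_one, one_mul] at hd hn
    show g' = h'
    apply ElemFrobenioidMonoid.ext
    · have hd' := congrArg (Multiplicative.toAdd (α := ℕ)) hd
      rw [toAdd_mul, toAdd_mul] at hd'
      exact (Multiplicative.toAdd (α := ℕ)).injective (by omega)
    · exact hn
  · -- not an isomorphism
    intro hiso
    have h1 := eq_one_of_isIso (show SingleObj.star StandardFrobenioid ⟶ SingleObj.star _ from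
      StandardFrobenioid.gen)
    have h2 := congrArg (fun x : StandardFrobenioid => Multiplicative.toAdd x.div) h1
    simp [StandardFrobenioid.gen] at h2
  · -- irreducible: `α · β = γ` forces `α = 1` or `β = 1`
    let a : StandardFrobenioid := α
    let b : StandardFrobenioid := β
    have e' : a * b = StandardFrobenioid.gen := e
    have hn := congrArg ElemFrobenioidMonoid.degFr e'
    simp only [ElemFrobenioidMonoid.mul_degFr, StandardFrobenioid.gen] at hn
    obtain ⟨ha1, hb1⟩ := pnat_eq_one_and_of_mul_eq_one hn
    have hd := congrArg (fun x : StandardFrobenioid => Multiplicative.toAdd x.div) e'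
    simp only [ElemFrobenioidMonoid.mul_div, StandardFrobenioid.gen, toAdd_mul, toAdd_pow, toAdd_ofAdd,
      smul_eq_mul, ha1, PNat.one_coe, one_mul] at hd
    rcases Nat.eq_zero_or_pos (Multiplicative.toAdd a.div) with ha0 | ha0
    · left
      have ha : a = 1 :=
        ElemFrobenioidMonoid.ext ((Multiplicative.toAdd (α := ℕ)).injective (by rw [ha0]; rfl)) ha1
      exact ⟨⟨(show SingleObj.star StandardFrobenioid ⟶ X from a),
        (show a * a = 1 by rw [ha, one_mul]), (show a * a = 1 by rw [ha, one_mul])⟩⟩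
    · right
      have hb0 : Multiplicative.toAdd b.div = 0 := by omega
      have hb : b = 1 :=
        ElemFrobenioidMonoid.ext ((Multiplicative.toAdd (α := ℕ)).injective (by rw [hb0]; rfl)) hb1
      exact ⟨⟨(show X ⟶ SingleObj.star StandardFrobenioid from b),
        (show b * b = 1 by rw [hb, one_mul]), (show b * b = 1 by rw [hb, one_mul])⟩⟩

/-- **Example 3.5** (FrdI p. 69): "`D` fails to be of FSMFF-type" — it has the FSMI endomorphism
`γ = (1,1)` (§0 p. 18). [cite: MochizukiFrdI2008, Ex. 3.5 p.69] -/
theorem not_isOfFSMFFType : ¬ IsOfFSMFFType D :=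
  fun h => h.not_isFSMI_of_endomorphism _ isFSMI_gen

/-- **Example 3.5** (FrdI p. 69): `C` "is of Frobenius-normalized type": for `α = (0, (a, 1)) ∈ O^▷`
and a base-identity `φ = (0, (c, d))`, `α^d · φ = (0, (d·a + c, d)) = φ · α` in `𝔽 × 𝔽`.
[cite: MochizukiFrdI2008, Ex. 3.5 p.69] -/
theorem isOfFrobeniusNormalizedType : data.IsOfFrobeniusNormalizedType := by
  refine ⟨fun A φ hφ α hα => ?_⟩
  obtain ⟨hαb, hαl⟩ := hα
  let a : StandardFrobenioid × StandardFrobenioid := α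
  let f : StandardFrobenioid × StandardFrobenioid := φ
  have hφ1 : f.1 = 1 := hφ
  have hα1 : a.1 = 1 := hαb
  have hα2 : a.2.degFr = 1 := hαl
  have hpow : (show StandardFrobenioid × StandardFrobenioid from α ^ (data.degFr φ : ℕ)) =
      a ^ (f.2.degFr : ℕ) := singleObj_end_pow_eq α _
  show (show StandardFrobenioid × StandardFrobenioid from α ^ (data.degFr φ : ℕ)) * f = f * a
  rw [hpow]
  obtain ⟨hdiv, hdeg⟩ := ElemFrobenioidMonoid.pow_of_degFr_eq_one a.2 hα2 (f.2.degFr : ℕ)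
  refine Prod.ext ?_ (ElemFrobenioidMonoid.ext ?_ ?_)
  · rw [Prod.fst_mul, Prod.fst_mul, Prod.pow_fst, hα1, hφ1, one_pow]
  · rw [Prod.snd_mul, Prod.snd_mul, Prod.pow_snd, ElemFrobenioidMonoid.mul_div,
      ElemFrobenioidMonoid.mul_div, hdiv, hdeg, PNat.one_coe, pow_one, mul_comm]
  · rw [Prod.snd_mul, Prod.snd_mul, Prod.pow_snd, ElemFrobenioidMonoid.mul_degFr,
      ElemFrobenioidMonoid.mul_degFr, hdeg, hα2, one_mul, mul_one]

/-- **Example 3.5** (FrdI p. 69): `C` is "of isotropic type": an isometric pre-step `((b), (0, 1))` has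
invertible, hence trivial, base component `b ∈ 𝔽`, so it is the identity.
[cite: MochizukiFrdI2008, Ex. 3.5 p.69] -/
theorem isOfIsotropicType : data.IsOfIsotropicType := by
  refine ⟨fun A B φ hφ => ?_⟩
  obtain ⟨⟨hl, hb⟩, hi⟩ := hφ
  let f : StandardFrobenioid × StandardFrobenioid := φ
  have h1 : f.1 = 1 := by
    haveI : IsIso (data.base.map φ) := hb
    exact eq_one_of_isIso (data.base.map φ)
  have h2 : f.2.degFr = 1 := hl
  have h3 : f.2.div = 1 := hi
  have hf : f = 1 := Prod.ext h1 (ElemFrobenioidMonoid.ext h3 h2)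
  exact ⟨⟨(show B ⟶ A from f), (show f * f = 1 by rw [hf, one_mul]), (show f * f = 1 by rw [hf, one_mul])⟩⟩

/-- **Example 3.5**, all typed claims PROVED (`Ex35.claims`): `γ = (1,1)` is an FSMI-morphism of `D`,
`D` is not of FSMFF-type, `C` is of Frobenius-normalized and isotropic type and not of group-like type.
[cite: MochizukiFrdI2008, Ex. 3.5 p.69] -/
theorem claims_holds : claims :=
  ⟨isFSMI_gen, not_isOfFSMFFType, isOfFrobeniusNormalizedType, isOfIsotropicType, not_isGroupLikeType⟩

end Ex35

/-! ### Example 3.10 -/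

namespace Ex310

variable {G : Type} [Group G]

/-- **Example 3.10** (FrdI p. 72): `C` is "of Frobenius-normalized type" — the same computation as in
Example 3.5, with `G` in the first factor. [cite: MochizukiFrdI2008, Ex. 3.10 p.72] -/
theorem isOfFrobeniusNormalizedType : (data G).IsOfFrobeniusNormalizedType := by
  refine ⟨fun A φ hφ α hα => ?_⟩
  obtain ⟨hαb, hαl⟩ := hα
  let a : G × StandardFrobenioid := α
  let f : G × StandardFrobenioid := φ
  have hφ1 : f.1 = 1 := hφ
  have hα1 : a.1 = 1 := hαb
  have hα2 : a.2.degFr = 1 := hαl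
  have hpow : (show G × StandardFrobenioid from α ^ ((data G).degFr φ : ℕ)) = a ^ (f.2.degFr : ℕ) :=
    singleObj_end_pow_eq α _
  show (show G × StandardFrobenioid from α ^ ((data G).degFr φ : ℕ)) * f = f * a
  rw [hpow]
  obtain ⟨hdiv, hdeg⟩ := ElemFrobenioidMonoid.pow_of_degFr_eq_one a.2 hα2 (f.2.degFr : ℕ)
  refine Prod.ext ?_ (ElemFrobenioidMonoid.ext ?_ ?_)
  · rw [Prod.fst_mul, Prod.fst_mul, Prod.pow_fst, hα1, hφ1, one_pow]
  · rw [Prod.snd_mul, Prod.snd_mul, Prod.pow_snd, ElemFrobenioidMonoid.mul_div,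
      ElemFrobenioidMonoid.mul_div, hdiv, hdeg, PNat.one_coe, pow_one, mul_comm]
  · rw [Prod.snd_mul, Prod.snd_mul, Prod.pow_snd, ElemFrobenioidMonoid.mul_degFr,
      ElemFrobenioidMonoid.mul_degFr, hdeg, hα2, one_mul, mul_one]

/-- In `C = ` one-object category of `G × 𝔽`, an arrow whose `𝔽`-component is trivial is an
isomorphism (inverse `(g⁻¹, 1)`). [cite: MochizukiFrdI2008, Ex. 3.10 p.72] -/
theorem isIso_of_snd_eq_one {A B : C G} (φ : A ⟶ B) (h : (show G × StandardFrobenioid from φ).2 = 1) :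
    IsIso φ := by
  let f : G × StandardFrobenioid := φ
  have hf : f.2 = 1 := h
  refine ⟨⟨(show B ⟶ A from ((f.1⁻¹, 1) : G × StandardFrobenioid)), ?_, ?_⟩⟩
  · show ((f.1⁻¹, 1) : G × StandardFrobenioid) * f = 1
    exact Prod.ext (inv_mul_cancel f.1) (show (1 : StandardFrobenioid) * f.2 = 1 by rw [hf, mul_one])
  · show f * ((f.1⁻¹, 1) : G × StandardFrobenioid) = 1
    exact Prod.ext (mul_inv_cancel f.1) (show f.2 * (1 : StandardFrobenioid) = 1 by rw [hf, mul_one])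

/-- In `C`, an isometric linear arrow is an isomorphism; in particular `C` is of isotropic type and every
arrow of `C` is co-angular. [cite: MochizukiFrdI2008, Ex. 3.10 p.72] -/
theorem isIso_of_isIsometry_of_isLinear {A B : C G} (φ : A ⟶ B) (hi : (data G).IsIsometry φ)
    (hl : (data G).IsLinear φ) : IsIso φ :=
  isIso_of_snd_eq_one φ (ElemFrobenioidMonoid.ext hi hl)

/-- **Example 3.10** (FrdI p. 72): `C` is "of isotropic type". [cite: MochizukiFrdI2008, Ex. 3.10 p.72] -/
theorem isOfIsotropicType : (data G).IsOfIsotropicType :=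
  ⟨fun _ _ φ hφ => isIso_of_isIsometry_of_isLinear φ hφ.2 hφ.1.1⟩

/-- **Example 3.10** (FrdI p. 72): `C` is "not of group-like type" (`Φ = ℤ_{≥0} ≠ 0`).
[cite: MochizukiFrdI2008, Ex. 3.10 p.72] -/
theorem not_isOfGroupLikeType : ¬ (data G).IsOfGroupLikeType := by
  intro h
  have h0 : (Multiplicative.ofAdd (1 : ℕ) : Multiplicative ℕ) = 1 :=
    h.obj (SingleObj.star _) (Multiplicative.ofAdd (1 : ℕ))
  have h1 := congrArg Multiplicative.toAdd h0
  rw [toAdd_ofAdd, toAdd_one] at h1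
  exact Nat.one_ne_zero h1

/-- **Example 3.10** (FrdI p. 72): "`D` is of FSM-type" — the one-object category of a group is a
groupoid, so every (FSM-)morphism is an isomorphism. [cite: MochizukiFrdI2008, Ex. 3.10 p.72] -/
theorem isOfFSMType : IsOfFSMType (D G) :=
  ⟨fun f _ => IsIso.of_groupoid f⟩

/-- Every arrow of `C` is co-angular (isometric pre-steps are isomorphisms).
[cite: MochizukiFrdI2008, Ex. 3.10 p.72] -/
theorem isCoAngular {A B : C G} (φ : A ⟶ B) : (data G).IsCoAngular φ :=
  fun _ _ _ β _ _ _ hβ _ => isIso_of_isIsometry_of_isLinear β hβ.2 hβ.1.1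

/-- **Example 3.10** (FrdI p. 72): for a nontrivial `α : 𝔽 → Z(G)` factoring through `𝔽 ↠ N_{≥1}`, the
self-equivalence `(g, f) ↦ (g · α(f), f)` "fails to preserve base-identity endomorphisms of Frobenius
type": with `α(0, n) ≠ 1`, the endomorphism `(1, (0, n))` is base-identity of Frobenius type and is
mapped to `(α(0, n), (0, n))`. [cite: MochizukiFrdI2008, Ex. 3.10 p.72] -/
theorem twist_not_preserves (α : StandardFrobenioid →* G) (hα : ∀ f, α f ∈ Subgroup.center G)
    (hfac : ∃ β : ℕ+ →* G, α = β.comp StandardFrobenioid.degHom) (hne : α ≠ 1) :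
    ∃ (A : C G) (φ : A ⟶ A), (data G).IsBaseIdentity φ ∧ (data G).IsFrobeniusType φ ∧
      ¬ (data G).IsBaseIdentity ((twist α hα).map φ) := by
  -- a value where `α` is nontrivial
  obtain ⟨u, hu⟩ : ∃ u : StandardFrobenioid, α u ≠ 1 := by
    by_contra h
    exact hne (MonoidHom.ext fun u => Classical.not_not.mp fun hu => h ⟨u, hu⟩)
  refine ⟨SingleObj.star _, (show SingleObj.star (G × StandardFrobenioid) ⟶ SingleObj.star _ from
    ((1, ⟨1, u.degFr⟩) : G × StandardFrobenioid)), rfl, ⟨⟨isCoAngular _, rfl⟩, ?_⟩, ?_⟩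
  · -- base-isomorphism: every arrow of the one-object category of the group `G` is invertible
    exact IsIso.of_groupoid _
  · -- the twisted arrow has base component `α(0, n) = α(u) ≠ 1`
    intro h
    have h' : (1 : G) * α ⟨1, u.degFr⟩ = 1 := h
    rw [one_mul] at h'
    apply hu
    obtain ⟨β, rfl⟩ := hfac
    exact h'

/-- **Example 3.10**, all typed claims PROVED (`Ex310.claims G`). [cite: MochizukiFrdI2008, Ex. 3.10 p.72] -/
theorem claims_holds : claims (G := G) :=
  ⟨isOfFrobeniusNormalizedType, isOfIsotropicType, not_isOfGroupLikeType, isOfFSMType,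
    fun α hα hfac hne => twist_not_preserves α hα hfac hne⟩

end Ex310

end Literature.AlgebraicGeometry.Frobenioids
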